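import Summits.ABC.IUTFork.ForkGenuineWindowSharpUpper
import Literature.IUT.LogVolume.LogRadiusBounds
import HarnessLib

/-!
# The fork at [IUTchIII] Corollary 3.12 at a GENUINE input: the `✱`-sharp computable half IMPROVES abc-iut-c312-d1's explicit
# Step (v) constant by one different per collection — `U♯(I) ≤ explicitDeltaRest I − Σ (max_b d_{v_b})·log p·Π Pr/ℓ⋇`

Record-only PROOF file (D-0012) of the abc-iut cell (seat abc-iut-w6-d018, «PROP12II-SHARP-UPPER», sequel of
`ForkGenuineWindowSharpUpper`); TAKES NO SIDE. abc-iut-c312-d1's computable half for a genuine input is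
`HullEstimateOf I (explicitDelta I)` with `explicitDelta = slotResidue + explicitDeltaRest`,
`explicitDeltaRest I = Σ_p (1/ℓ⋇)Σ_jΣ_{v⃗} ({d_I(v⃗) + 1}·log p + Σ_{a : e_a > p−2}{3 + log e_a})·Π Pr` ([IUTchIV] Thm. 1.10 Step
(v), the second displayed inequality of Prop. 1.4 (iii)). The `✱`-sharp upper window of `ForkGenuineWindowSharpUpper` has
instead `U♯(I) = Σ_p (1/ℓ⋇)Σ_jΣ_{v⃗} (d_I(v⃗) − max_b d_{v_b} + a_I(v⃗) + b_I(v⃗) + 1)·log p·Π Pr`. By Prop. 1.4 (iii)'s own step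
"`(a_I + b_I)·log(p) ≤ Σ_{i∈I*}{3 + log(e_i)}`" (proof p. 14; the tree's `sum_logRadius_mul_log_le`, abc-iut-S2) the two compare:

* `upperSharpTerm_le_restTerm_sub` — per collection: `(d_I − max_b d_{v_b} + a_I + b_I + 1)·log p ≤
  ({d_I + 1}·log p + Σ_{e_a > p−2}{3 + log e_a}) − (max_b d_{v_b})·log p`;
* **`upperSharp_le_explicitDeltaRest_sub`** — `U♯(I) ≤ explicitDeltaRest I − Σ_p (1/ℓ⋇)Σ_jΣ_{v⃗} (max_b d_{v_b})·log p·Π Pr`;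
* **`hullEstimateOf_explicitDelta_sub_maxDifferent`** — hence `HullEstimateOf I (explicitDelta I − Σ_p (1/ℓ⋇)Σ_jΣ_{v⃗}
  (max_b d_{v_b})·log p·Π Pr)` UNCONDITIONALLY: c312-d1's explicit constant improved by the largest different of each
  collection (Prop. 1.1's `✱`-slot is never charged).
Nothing asserted about any input; classical bookkeeping; no side taken on [IUTchIII] Cor. 3.12; typed ≠ proved. PROOF-ONLY file.
[cite: Mochizuki2012, IUTchIV Prop. 1.1 p. 9, Prop. 1.4 (iii) p. 13–14, Thm. 1.10 Step (v) p. 27–28] [cite: DupuyHilado2025, §4.12]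
-/

noncomputable section

open Set Literature.IUT.LogVolume NumberField IsDedekindDomain
open scoped Pointwise

namespace Summit.ABC.IUTFork.GenuineContent

section Rest

variable {F₀ : Type} [Field F₀] [NumberField F₀] {K : Type} [Field K] [NumberField K] [Algebra F₀ K]
variable (I : ThetaVolumeInput F₀ K)

/-- **Per collection**: `(d_I − max_b d_{v_b} + a_I + b_I + 1)·log p ≤ ({d_I + 1}·log p + Σ_{e_a > p−2}{3 + log e_a}) −
(max_b d_{v_b})·log p` (Prop. 1.4 (iii), proof p. 14: `(a_I + b_I)·log p ≤ Σ_{i∈I*}{3 + log e_i}` with `I* = {a : e_a > p − 2}`).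
[cite: Mochizuki2012, IUTchIV Prop. 1.4 (iii) proof p. 14] -/
theorem upperSharpTerm_le_restTerm_sub {p : ℕ} [hp : Fact p.Prime] (i : Fin I.X.lstar)
    (e : Fin ((i : ℕ) + 1 + 1) → placesOver F₀ p) :
    (dSum p (fun b => (I.σ.localFieldFamily p hp.out).k (e b))
        - Finset.univ.sup' ⟨0, Finset.mem_univ _⟩
            (fun b => differentOrd p ((I.σ.localFieldFamily p hp.out).k (e b)))
        + aSum p (fun b => (I.σ.localFieldFamily p hp.out).k (e b))
        + bSum p (fun b => (I.σ.localFieldFamily p hp.out).k (e b)) + 1) * Real.log p ≤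
      ((dSum p (fun b => (I.σ.localFieldFamily p hp.out).k (e b)) + 1) * Real.log p
          + ∑ a ∈ Finset.univ.filter
              (fun a => p - 2 < absRamificationIdx p ((I.σ.localFieldFamily p hp.out).k (e a))),
              (3 + Real.log (absRamificationIdx p ((I.σ.localFieldFamily p hp.out).k (e a)))))
        - Finset.univ.sup' ⟨0, Finset.mem_univ _⟩
            (fun b => differentOrd p ((I.σ.localFieldFamily p hp.out).k (e b))) * Real.log p := by
  have hab := sum_logRadius_mul_log_le (p := p) (I := (Finset.univ : Finset (Fin ((i : ℕ) + 1 + 1))))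
    (Istar := Finset.univ.filter
      (fun a => p - 2 < absRamificationIdx p ((I.σ.localFieldFamily p hp.out).k (e a))))
    (e := fun a => absRamificationIdx p ((I.σ.localFieldFamily p hp.out).k (e a))) hp.out
    (fun a _ => absRamificationIdx_pos p _) (Finset.filter_subset _ _)
    (fun a _ ha => by
      rw [Finset.mem_filter, not_and] at ha
      exact Nat.le_of_not_lt (ha (Finset.mem_univ a)))
  rw [Finset.sum_add_distrib] at hab
  have haI : aSum p (fun b => (I.σ.localFieldFamily p hp.out).k (e b)) =
      ∑ a, logRadiusA p (absRamificationIdx p ((I.σ.localFieldFamily p hp.out).k (e a))) := rfl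
  have hbI : bSum p (fun b => (I.σ.localFieldFamily p hp.out).k (e b)) =
      ∑ a, logRadiusB p (absRamificationIdx p ((I.σ.localFieldFamily p hp.out).k (e a))) := rfl
  rw [haI, hbI]
  nlinarith [hab, Real.log_nonneg (show (1 : ℝ) ≤ p by exact_mod_cast hp.out.one_lt.le)]

/-- **`U♯(I) ≤ explicitDeltaRest I − Σ_p (1/ℓ⋇)Σ_jΣ_{v⃗} (max_b d_{v_b})·log p·Π Pr`**: the `✱`-sharp computable constant is c312-d1's
print-shaped constant MINUS the largest different of every collection. [cite: Mochizuki2012, IUTchIV Thm. 1.10 Step (v) p. 27–28] -/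
theorem upperSharp_le_explicitDeltaRest_sub :
    ∑ p ∈ I.supportPrimes, (1 / (I.X.lstar : ℝ)) * ∑ i : Fin I.X.lstar,
        ∑ e : Fin ((i : ℕ) + 1 + 1) → placesOver F₀ p,
          (if hp : p.Prime then
            haveI : Fact p.Prime := ⟨hp⟩
            (dSum p (fun b => (I.σ.localFieldFamily p hp).k (e b))
              - Finset.univ.sup' ⟨0, Finset.mem_univ _⟩
                  (fun b => differentOrd p ((I.σ.localFieldFamily p hp).k (e b)))
              + aSum p (fun b => (I.σ.localFieldFamily p hp).k (e b))
              + bSum p (fun b => (I.σ.localFieldFamily p hp).k (e b)) + 1) * Real.log p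
           else 0) * ∏ b, weight F₀ (e b).1 ≤
      DHData.explicitDeltaRest I
        - ∑ p ∈ I.supportPrimes, (1 / (I.X.lstar : ℝ)) * ∑ i : Fin I.X.lstar,
            ∑ e : Fin ((i : ℕ) + 1 + 1) → placesOver F₀ p,
              (if hp : p.Prime then
                haveI : Fact p.Prime := ⟨hp⟩
                Finset.univ.sup' ⟨0, Finset.mem_univ _⟩
                  (fun b => differentOrd p ((I.σ.localFieldFamily p hp).k (e b))) * Real.log p
               else 0) * ∏ b, weight F₀ (e b).1 := by
  unfold DHData.explicitDeltaRest
  rw [← Finset.sum_sub_distrib]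
  refine Finset.sum_le_sum fun p hpT => ?_
  have hp' : p.Prime := I.prime_of_mem_supportPrimes hpT
  haveI hp : Fact p.Prime := ⟨hp'⟩
  simp only [dif_pos hp']
  rw [← mul_sub, ← Finset.sum_sub_distrib]
  refine mul_le_mul_of_nonneg_left (Finset.sum_le_sum fun i _ => ?_) (one_div_lstar_nonneg I)
  rw [← Finset.sum_sub_distrib]
  refine Finset.sum_le_sum fun e _ => ?_
  have hg : p.Prime ∧ 0 < (i : ℕ) + 1 ∧ (i : ℕ) + 1 - 1 < I.X.lstar := ⟨hp', Nat.succ_pos _, by simp [i.2]⟩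
  rw [dif_pos hg, ← sub_mul]
  exact mul_le_mul_of_nonneg_right (upperSharpTerm_le_restTerm_sub I i e) (prod_weight_nonneg e)

/-- **c312-d1's explicit constant improved by the largest different of each collection**:
`HullEstimateOf I (explicitDelta I − Σ_p (1/ℓ⋇)Σ_jΣ_{v⃗} (max_b d_{v_b})·log p·Π Pr)` for every genuine input, unconditionally
(`explicitDelta = slotResidue + explicitDeltaRest`, `hullEstimateOf_slotResidue_add_upperSharp`, `upperSharp_le_explicitDeltaRest_sub`).
[cite: Mochizuki2012, IUTchIV Thm. 1.10 Steps (iv)–(viii) p. 26–30] [cite: DupuyHilado2025, §4.12] -/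
theorem hullEstimateOf_explicitDelta_sub_maxDifferent :
    I.HullEstimateOf (DHData.explicitDelta I
      - ∑ p ∈ I.supportPrimes, (1 / (I.X.lstar : ℝ)) * ∑ i : Fin I.X.lstar,
          ∑ e : Fin ((i : ℕ) + 1 + 1) → placesOver F₀ p,
            (if hp : p.Prime then
              haveI : Fact p.Prime := ⟨hp⟩
              Finset.univ.sup' ⟨0, Finset.mem_univ _⟩
                (fun b => differentOrd p ((I.σ.localFieldFamily p hp).k (e b))) * Real.log p
             else 0) * ∏ b, weight F₀ (e b).1) := by
  have h0 := hullEstimateOf_slotResidue_add_upperSharp I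
  have h1 := upperSharp_le_explicitDeltaRest_sub I
  rw [DHData.explicitDelta_eq_slotResidue_add_rest]
  unfold ThetaVolumeInput.HullEstimateOf at h0 ⊢
  linarith

end Rest

end Summit.ABC.IUTFork.GenuineContent

end
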